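import Summits.QuantumFields.BalabanUV.T4Continuum.Support.NE3BlockLineAverage
import Summits.QuantumFields.BalabanUV.T4Continuum.Support.ScalarBlockPoincareLocal
import HarnessLib

/-!
# T⁴ programme, node NE3 — TWO POINCARÉ INEQUALITIES ON THE PERIOD BOX (complex values): the block∕torus mean inequality
# `Σ‖f − mean‖² ≤ (M²∕2)·Σ‖∂f‖²`, and for an EXACT periodic 1-form `Σ‖dG‖² ≤ (N²∕2)·Σ‖div dG‖²`

NE3 formalisation swarm `b2b-balaban-t4-ne3-formalise-*`, LEAF PROVER 04 (gen 4), row **E-MLw-w3** of `t4/formal/NE3/LEAVES.md`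
(typer v1.44; owner skeleton v1.9 §4b (w3)), file (C1) of the SHAPE note `t4/formal/NE3/Statements/E-MLw-w3-SHAPE-v1.md`.

WHY.  By file (A) (`NE3TangentFlatStructure.iterate_Tcoarse_eq`) a k-fold tangent direction at the flat background has a
COARSE-EXACT straight k-block average: `(Qcoarse L)^[k] Y = dPot G` with an `N`-periodic potential `G` on the coarse torus
(`N` = torus size in `L^k`-blocks).  The frame potential `G` is rough; what the gradient of `Y` controls is the coarse DIVERGENCE of
`dPot G` (file (B)).  The missing link is the statement of this file: on the discrete `N`-torus an exact 1-form is controlled by its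
divergence up to the torus Poincaré constant — `Σ‖dPot G‖² = −Σ⟪G − Ḡ, div dPot G⟫ ≤ ‖G − Ḡ‖·‖div dPot G‖` and
`‖G − Ḡ‖² ≤ (N²∕2)·Σ‖dPot G‖²`.  The mean inequality is the tree's coordinate-cube Poincaré inequality
`ScalarBlockPoincareLocal.sum_norm_sub_mean_sq_le_cube` (constant `n(n+1)∕2`, `d`-free; from `Beta.CoordCubePoincare`) transported
to lattice blocks `q + [0,M)^d` by the chart `boxVec`.

CONTENT (all [folklore]; 0 sorry; 0 def; complex values — the matrix case is taken entrywise in file (C2)):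
§1 `boxVec_stepUp` (the chart intertwines `stepUp` with `+ e_μ` off the last layer); **`sum_norm_sub_blockMean_sq_le`**:
   `Σ_{v∈[0,M)^d} ‖f(q+v) − (Σ_v f(q+v))∕M^d‖² ≤ (M²∕2)·Σ_{v∈[0,M)^d} Σ_μ ‖f(q+v+e_μ) − f(q+v)‖²` (`M ≥ 1`, any `q`).
§2 periodic summation by parts on `periodBox N` for real inner products of `N`-periodic complex lattice functions:
   `sum_sq_dPot_eq_neg_sum_inner_div` (`Σ_xΣ_κ‖dPot G x κ‖² = −Σ_x ⟪G x − c, Σ_κ(dPot G x κ − dPot G (x−e_κ) κ)⟫`, every `c`),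
   and **`sum_sq_dPot_le_of_periodic`**: `Σ_{x∈periodBox N} Σ_κ ‖dPot G x κ‖² ≤ (N²∕2)·Σ_{x∈periodBox N} ‖Σ_κ (dPot G x κ −
   dPot G (x − e_κ) κ)‖²` for `N`-periodic `G` (`N ≥ 1`) — AN EXACT PERIODIC 1-FORM IS BOUNDED BY ITS DIVERGENCE, constant `N²∕2`.

HONEST FRAMING.  Elementary lattice analysis on a discrete torus; nothing about Bałaban's minimisers, (ML_w), T-E_w or NE3 is
asserted; NE3 NOT proved; spine 0∕9; finite T⁴ rung (B)+1 — NOT infinite volume, NOT mass gap, NOT BetaPertH, NOT Clay.  The `N²`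
is the price of the single-bar tangent space (SHAPE note §1); on `ker (Qcoarse L)^[k]` file (C2) needs nothing from §2.
PLACEMENT: `Summits/QuantumFields/BalabanUV/`; imports file (B) and the tree's `ScalarBlockPoincareLocal` BY NAME.
-/

set_option autoImplicit false

open scoped BigOperators InnerProductSpace
open Finset

namespace Summit.QuantumFields.BalabanUV.T4Continuum.NE3CoarseTorusExact

open Literature.MathematicalPhysics.QuantumFieldTheory.Balaban1983to89
open B7Prop1Explicit
open Beta.CoordCubePoincare (stepUp)
open T4AveragingDeficitWallBoundary (periodBox mem_periodBox card_periodBox sum_periodBox_shift)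
open NE3TangentNoGoWords (dPot)
open NE3BlockLineAverage (sum_univ_boxVec)
open ScalarBlockPoincareLocal (sum_norm_sub_mean_sq_le_cube)

noncomputable section

variable {d : ℕ}

/-! ## §1 The mean Poincaré inequality on a lattice block -/

/-- The chart `boxVec` intertwines the cube step with the lattice step off the last layer:
`boxVec (n+1) (stepUp r μ) = boxVec (n+1) r + e_μ` when `r μ ≠ last`. [folklore] -/
theorem boxVec_stepUp {n : ℕ} (r : Fin d → Fin (n + 1)) (μ : Fin d) (h : r μ ≠ Fin.last n) :
    boxVec (n + 1) (stepUp r μ) = boxVec (n + 1) r + e μ := by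
  funext κ
  simp only [boxVec, stepUp, Pi.add_apply, e_apply, Function.update_apply]
  by_cases hκ : κ = μ
  · subst hκ
    simp only [if_true, Fin.val_add_one_of_lt (Fin.lt_last_iff_ne_last.mpr h)]
    push_cast; ring
  · simp [hκ]

/-- **THE MEAN POINCARÉ INEQUALITY ON A LATTICE BLOCK** (complex values): for every corner `q` and side `M ≥ 1`,
`Σ_{v∈[0,M)^d} ‖f(q+v) − (Σ_v f(q+v))∕M^d‖² ≤ (M²∕2)·Σ_{v∈[0,M)^d} Σ_μ ‖f(q+v+e_μ) − f(q+v)‖²` — the tree's coordinate-cube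
inequality (constant `(M−1)M∕2 ≤ M²∕2`, `d`-free) in the chart `v = boxVec M r`; the bonds leaving the block only enlarge the right
side. [folklore] -/
theorem sum_norm_sub_blockMean_sq_le {M : ℕ} (hM : 1 ≤ M) (f : Site d → ℂ) (q : Site d) :
    ∑ v ∈ periodBox (d := d) M, ‖f (q + v) - (∑ w ∈ periodBox (d := d) M, f (q + w)) / ((M : ℂ) ^ d)‖ ^ 2
      ≤ (M : ℝ) ^ 2 / 2 * ∑ v ∈ periodBox (d := d) M, ∑ μ : Fin d, ‖f (q + v + e μ) - f (q + v)‖ ^ 2 := by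
  obtain ⟨n, rfl⟩ : ∃ n, M = n + 1 := ⟨M - 1, by omega⟩
  have hcube := sum_norm_sub_mean_sq_le_cube n d (fun r => f (q + boxVec (n + 1) r))
  have hcard : ((Fintype.card (Fin d → Fin (n + 1)) : ℕ) : ℂ) = ((n + 1 : ℕ) : ℂ) ^ d := by
    rw [Fintype.card_fun, Fintype.card_fin, Fintype.card_fin]; push_cast; ring
  rw [hcard] at hcube
  -- left side: the chart
  have hL : ∑ v ∈ periodBox (d := d) (n + 1), ‖f (q + v) - (∑ w ∈ periodBox (d := d) (n + 1), f (q + w)) / (((n + 1 : ℕ) : ℂ) ^ d)‖ ^ 2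
      = ∑ r : Fin d → Fin (n + 1), ‖f (q + boxVec (n + 1) r)
          - (∑ r' : Fin d → Fin (n + 1), f (q + boxVec (n + 1) r')) / (((n + 1 : ℕ) : ℂ) ^ d)‖ ^ 2 := by
    rw [← sum_univ_boxVec (n + 1) (fun v => f (q + v))]
    exact (sum_univ_boxVec (n + 1) (fun v => ‖f (q + v)
      - (∑ r' : Fin d → Fin (n + 1), f (q + boxVec (n + 1) r')) / (((n + 1 : ℕ) : ℂ) ^ d)‖ ^ 2)).symm
  -- right side: filtered cube sums are dominated by the full lattice sums
  have hR : ∀ μ : Fin d,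
      ∑ r ∈ univ.filter (fun r : Fin d → Fin (n + 1) => r μ ≠ Fin.last n),
          ‖f (q + boxVec (n + 1) (stepUp r μ)) - f (q + boxVec (n + 1) r)‖ ^ 2
        ≤ ∑ v ∈ periodBox (d := d) (n + 1), ‖f (q + v + e μ) - f (q + v)‖ ^ 2 := by
    intro μ
    rw [← sum_univ_boxVec (n + 1) (fun v => ‖f (q + v + e μ) - f (q + v)‖ ^ 2)]
    calc ∑ r ∈ univ.filter (fun r : Fin d → Fin (n + 1) => r μ ≠ Fin.last n),
            ‖f (q + boxVec (n + 1) (stepUp r μ)) - f (q + boxVec (n + 1) r)‖ ^ 2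
        = ∑ r ∈ univ.filter (fun r : Fin d → Fin (n + 1) => r μ ≠ Fin.last n),
            ‖f (q + boxVec (n + 1) r + e μ) - f (q + boxVec (n + 1) r)‖ ^ 2 := by
          refine Finset.sum_congr rfl fun r hr => ?_
          rw [boxVec_stepUp r μ (Finset.mem_filter.mp hr).2, add_assoc]
      _ ≤ ∑ r : Fin d → Fin (n + 1), ‖f (q + boxVec (n + 1) r + e μ) - f (q + boxVec (n + 1) r)‖ ^ 2 :=
          Finset.sum_le_sum_of_subset_of_nonneg (Finset.filter_subset _ _) fun _ _ _ => sq_nonneg _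
  rw [hL]
  refine hcube.trans ?_
  have hconst : (n : ℝ) * (n + 1) / 2 ≤ ((n + 1 : ℕ) : ℝ) ^ 2 / 2 := by
    have hn : (0 : ℝ) ≤ n := Nat.cast_nonneg n
    push_cast
    nlinarith [hn]
  have hsum_nonneg : 0 ≤ ∑ v ∈ periodBox (d := d) (n + 1), ∑ μ : Fin d, ‖f (q + v + e μ) - f (q + v)‖ ^ 2 := by positivity
  calc (n : ℝ) * (n + 1) / 2 * ∑ μ : Fin d, ∑ r ∈ univ.filter (fun r : Fin d → Fin (n + 1) => r μ ≠ Fin.last n),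
          ‖f (q + boxVec (n + 1) (stepUp r μ)) - f (q + boxVec (n + 1) r)‖ ^ 2
      ≤ (n : ℝ) * (n + 1) / 2 * ∑ μ : Fin d, ∑ v ∈ periodBox (d := d) (n + 1), ‖f (q + v + e μ) - f (q + v)‖ ^ 2 :=
        mul_le_mul_of_nonneg_left (Finset.sum_le_sum fun μ _ => hR μ) (by positivity)
    _ = (n : ℝ) * (n + 1) / 2 * ∑ v ∈ periodBox (d := d) (n + 1), ∑ μ : Fin d, ‖f (q + v + e μ) - f (q + v)‖ ^ 2 := by
        rw [Finset.sum_comm]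
    _ ≤ ((n + 1 : ℕ) : ℝ) ^ 2 / 2 * ∑ v ∈ periodBox (d := d) (n + 1), ∑ μ : Fin d, ‖f (q + v + e μ) - f (q + v)‖ ^ 2 :=
        mul_le_mul_of_nonneg_right hconst hsum_nonneg

/-- The same at the corner `q = 0` of the period box, with the mean written as `Ḡ`: for `M ≥ 1`,
`Σ_{x∈[0,M)^d} ‖G x − Ḡ‖² ≤ (M²∕2)·Σ_{x∈[0,M)^d} Σ_μ ‖dPot G x μ‖²`. [folklore] -/
theorem sum_norm_sub_mean_sq_le_periodBox {M : ℕ} (hM : 1 ≤ M) (G : Site d → ℂ) :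
    ∑ x ∈ periodBox (d := d) M, ‖G x - (∑ w ∈ periodBox (d := d) M, G w) / ((M : ℂ) ^ d)‖ ^ 2
      ≤ (M : ℝ) ^ 2 / 2 * ∑ x ∈ periodBox (d := d) M, ∑ μ : Fin d, ‖dPot G x μ‖ ^ 2 := by
  have h := sum_norm_sub_blockMean_sq_le hM G 0
  simp only [zero_add] at h
  exact h

/-! ## §2 An exact periodic 1-form is bounded by its divergence -/

/-- Periodic shift of a real-valued box sum by one unit step backwards: `Σ_x g(x − e_κ) = Σ_x g x`. [folklore] -/
theorem sum_periodBox_sub_e {N : ℕ} (hN : 1 ≤ N) {g : Site d → ℝ}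
    (hg : ∀ (x : Site d) (τ : Fin d), g (x + (N : ℤ) • e τ) = g x) (κ : Fin d) :
    ∑ x ∈ periodBox (d := d) N, g (x - e κ) = ∑ x ∈ periodBox (d := d) N, g x := by
  have h := sum_periodBox_shift N hN hg (-e κ)
  simpa [sub_eq_add_neg] using h

/-- Periodic shift by one unit step forwards. [folklore] -/
theorem sum_periodBox_add_e {N : ℕ} (hN : 1 ≤ N) {g : Site d → ℝ}
    (hg : ∀ (x : Site d) (τ : Fin d), g (x + (N : ℤ) • e τ) = g x) (κ : Fin d) :
    ∑ x ∈ periodBox (d := d) N, g (x + e κ) = ∑ x ∈ periodBox (d := d) N, g x :=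
  sum_periodBox_shift N hN hg (e κ)

/-- **PERIODIC SUMMATION BY PARTS**: for `N`-periodic `G` and every constant `c`,
`Σ_{x∈periodBox N} Σ_κ ‖dPot G x κ‖² = −Σ_x ⟪G x − c, Σ_κ (dPot G x κ − dPot G (x − e_κ) κ)⟫_ℝ`. [folklore] -/
theorem sum_sq_dPot_eq_neg_sum_inner_div {N : ℕ} (hN : 1 ≤ N) {G : Site d → ℂ}
    (hG : ∀ (x : Site d) (τ : Fin d), G (x + (N : ℤ) • e τ) = G x) (c : ℂ) :
    ∑ x ∈ periodBox (d := d) N, ∑ κ : Fin d, ‖dPot G x κ‖ ^ 2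
      = -∑ x ∈ periodBox (d := d) N, ⟪G x - c, ∑ κ : Fin d, (dPot G x κ - dPot G (x - e κ) κ)⟫_ℝ := by
  -- periodicity of the coboundary
  have hF : ∀ (x : Site d) (τ κ : Fin d), dPot G (x + (N : ℤ) • e τ) κ = dPot G x κ := by
    intro x τ κ
    simp only [dPot]
    rw [add_right_comm, hG, hG]
  -- per direction
  have hκ : ∀ κ : Fin d, ∑ x ∈ periodBox (d := d) N, ‖dPot G x κ‖ ^ 2
      = -∑ x ∈ periodBox (d := d) N, ⟪G x - c, dPot G x κ - dPot G (x - e κ) κ⟫_ℝ := by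
    intro κ
    have h1 : ∀ x : Site d, ‖dPot G x κ‖ ^ 2 = ⟪G (x + e κ) - c, dPot G x κ⟫_ℝ - ⟪G x - c, dPot G x κ⟫_ℝ := by
      intro x
      rw [← real_inner_self_eq_norm_sq, ← inner_sub_left]
      congr 1
      simp only [dPot]; ring
    simp_rw [h1]
    rw [Finset.sum_sub_distrib]
    -- shift the first sum back by `e κ`
    have hshift : ∑ x ∈ periodBox (d := d) N, ⟪G (x + e κ) - c, dPot G x κ⟫_ℝ
        = ∑ x ∈ periodBox (d := d) N, ⟪G x - c, dPot G (x - e κ) κ⟫_ℝ := by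
      have hper : ∀ (x : Site d) (τ : Fin d),
          ⟪G (x + (N : ℤ) • e τ) - c, dPot G (x + (N : ℤ) • e τ - e κ) κ⟫_ℝ = ⟪G x - c, dPot G (x - e κ) κ⟫_ℝ := by
        intro x τ
        rw [hG, add_sub_right_comm, hF]
      have h := sum_periodBox_add_e hN (g := fun y => ⟪G y - c, dPot G (y - e κ) κ⟫_ℝ) hper κ
      simp only [add_sub_cancel_right] at h
      exact h
    rw [hshift, ← Finset.sum_sub_distrib]
    rw [← Finset.sum_neg_distrib]
    refine Finset.sum_congr rfl fun x _ => ?_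
    rw [inner_sub_right]
    ring
  rw [Finset.sum_comm]
  simp_rw [hκ]
  simp_rw [← Finset.sum_neg_distrib]
  rw [Finset.sum_comm]
  refine Finset.sum_congr rfl fun x _ => ?_
  rw [inner_sum, Finset.sum_neg_distrib]

/-- **AN EXACT PERIODIC 1-FORM IS BOUNDED BY ITS DIVERGENCE** (discrete torus of side `N ≥ 1`, complex values):
`Σ_{x∈periodBox N} Σ_κ ‖dPot G x κ‖² ≤ (N²∕2)·Σ_{x∈periodBox N} ‖Σ_κ (dPot G x κ − dPot G (x − e_κ) κ)‖²` for `N`-periodic `G` —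
summation by parts against `G − Ḡ`, Cauchy–Schwarz, and the torus mean inequality `Σ‖G − Ḡ‖² ≤ (N²∕2)Σ‖dPot G‖²`. [folklore] -/
theorem sum_sq_dPot_le_of_periodic {N : ℕ} (hN : 1 ≤ N) {G : Site d → ℂ}
    (hG : ∀ (x : Site d) (τ : Fin d), G (x + (N : ℤ) • e τ) = G x) :
    ∑ x ∈ periodBox (d := d) N, ∑ κ : Fin d, ‖dPot G x κ‖ ^ 2
      ≤ (N : ℝ) ^ 2 / 2 * ∑ x ∈ periodBox (d := d) N, ‖∑ κ : Fin d, (dPot G x κ - dPot G (x - e κ) κ)‖ ^ 2 := by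
  set a : ℝ := ∑ x ∈ periodBox (d := d) N, ∑ κ : Fin d, ‖dPot G x κ‖ ^ 2 with ha
  set b : ℝ := ∑ x ∈ periodBox (d := d) N, ‖∑ κ : Fin d, (dPot G x κ - dPot G (x - e κ) κ)‖ ^ 2 with hb
  set m : ℂ := (∑ w ∈ periodBox (d := d) N, G w) / ((N : ℂ) ^ d) with hm
  set v : ℝ := ∑ x ∈ periodBox (d := d) N, ‖G x - m‖ ^ 2 with hv
  have ha0 : 0 ≤ a := by positivity
  have hb0 : 0 ≤ b := by positivity
  have hv0 : 0 ≤ v := by positivity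
  -- summation by parts + Cauchy–Schwarz: `a ≤ √v · √b`
  have h1 : a ≤ Real.sqrt v * Real.sqrt b := by
    rw [ha, sum_sq_dPot_eq_neg_sum_inner_div hN hG m]
    refine (neg_le_abs _).trans ?_
    refine (Finset.abs_sum_le_sum_abs _ _).trans ?_
    calc ∑ x ∈ periodBox (d := d) N, |⟪G x - m, ∑ κ : Fin d, (dPot G x κ - dPot G (x - e κ) κ)⟫_ℝ|
        ≤ ∑ x ∈ periodBox (d := d) N, ‖G x - m‖ * ‖∑ κ : Fin d, (dPot G x κ - dPot G (x - e κ) κ)‖ :=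
          Finset.sum_le_sum fun x _ => abs_real_inner_le_norm _ _
      _ ≤ Real.sqrt (∑ x ∈ periodBox (d := d) N, ‖G x - m‖ ^ 2)
            * Real.sqrt (∑ x ∈ periodBox (d := d) N, ‖∑ κ : Fin d, (dPot G x κ - dPot G (x - e κ) κ)‖ ^ 2) :=
          Real.sum_mul_le_sqrt_mul_sqrt _ _ _
  -- the torus mean inequality: `v ≤ (N²/2)·a`
  have h2 : v ≤ (N : ℝ) ^ 2 / 2 * a := sum_norm_sub_mean_sq_le_periodBox hN G
  -- conclude: `a² ≤ v·b ≤ (N²/2)·a·b`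
  have h3 : a ^ 2 ≤ (N : ℝ) ^ 2 / 2 * a * b := by
    have hsq : a ^ 2 ≤ (Real.sqrt v * Real.sqrt b) ^ 2 := pow_le_pow_left₀ ha0 h1 2
    rw [mul_pow, Real.sq_sqrt hv0, Real.sq_sqrt hb0] at hsq
    calc a ^ 2 ≤ v * b := hsq
      _ ≤ (N : ℝ) ^ 2 / 2 * a * b := mul_le_mul_of_nonneg_right h2 hb0
  by_cases hz : a = 0
  · rw [hz]; positivity
  · have hpos : 0 < a := lt_of_le_of_ne ha0 (Ne.symm hz)
    have : a * a ≤ a * ((N : ℝ) ^ 2 / 2 * b) := by nlinarith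
    exact le_of_mul_le_mul_left this hpos

end

end Summit.QuantumFields.BalabanUV.T4Continuum.NE3CoarseTorusExact
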